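import Literature.AlgebraicGeometry.HodgeTheory.QuarticCMTwoOnePowersHodgeClasses
import Mathlib.LinearAlgebra.Lagrange
import HarnessLib

/-!
# `Hg = U_E` (E a CM field) ⟹ `B = D` on all powers, IV: `End_Hdg(H¹) = ℚ[φ^*]` for a centre of any degree and the crossed classes of each colour are divisor classes (Deligne LNM 900 §4; Milne 1999 Prop. 3.3; Lagrange interpolation on the `2|ι|` eigenvalues)

Family `hodge`, layer `Literature/AlgebraicGeometry/HodgeTheory`. Research context: cell `pub-hodgeav-hg6` (LADDER-HodgeAV
PERC-SHAPE row 2, «base of HC ladder», req-37 Q2b TABLE X rows 10 / 12; HONEST FRAMING: nothing here proves HC, HC_AV or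
HC_CM; not a corollary). UNCONDITIONAL; theorems only, no definition, no named fact (D-0026), no `sorry`. Part IV of the
coloured socket (`CMHodgeGroupSlotsHodgeClasses`, `CMHodgeGroupDualBases`, `CMHodgeGroupPowersHodgeClasses`): the two
GEOMETRIC inputs of its assembly, for a commutative centre `E = ℚ[φ^*] = End⁰(A)` of ANY degree `m = 2|ι|`.
* §1 `baseChange_sum_smul_pow_apply_fin` (`(Σ_{k<m} q_k φ^k)_ℂ w = (Σ_k q_k c^k) w` on `W_c`; the tree's
  `baseChange_sum_smul_pow_apply` is `m = 4`), **`exists_eq_sum_smul_pow_bettiMapHom_fin`** — `End_Hdg(H¹(A;ℚ)) =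
  Σ_{k<m} ℚ (φ^*_ℚ)^k` when `finrank_ℚ End⁰(A) = m` and `φ^*_ℂ` has `m` distinct eigenvalues with non-zero eigenspaces
  (Vandermonde; the tree's `exists_eq_sum_smul_pow_bettiMapHom` is `m = 4`, its proof copied with `4 ↦ m`, credited).
* §2 **`sum_cupH1_cmColour_mem_span_rational_oneOne`** — for adapted `ψ_ℂ`-dual bases `cb ((k,t),ℓ)` of `H¹ ⊗ ℂ` with
  colours `k : ι` (eigenvalues `μ k`, `conj μ k` of `φ_ℂ`, the `2|ι|` numbers pairwise distinct), the crossed class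
  `θ_k = ∑_ℓ cb((k,0),ℓ) ⌣ cb((k,1),ℓ)` of EACH colour is in `B¹(A) ⊗ ℂ`: the `ψ`-Casimir class of `(φ^j)_ℂ` is the
  RATIONAL `(1,1)`-class `Σ_k ((μ k)^j + (conj μ k)^j) θ_k` (Milne Prop. 3.3; the tree's two-colour computation
  `sum_cupH1_colour_mem_span_rational_oneOne` VERBATIM up to the separation step, credited), and the Lagrange interpolation
  polynomial `L` of the node `μ k` among the `2|ι|` eigenvalues gives `θ_k = Σ_j L_j · Casimir((φ^j)_ℂ)` (complex
  coefficients, rational classes). This replaces the quartic file's ad-hoc separation of two colours by `1, φ, φ²`.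

## References

* [Deligne1982HodgeCycles] P. Deligne, *Hodge cycles on abelian varieties*, LNM 900 (1982), §4 (p. 30).
* [Milne1999LefschetzClasses] J. S. Milne, Duke Math. J. 96 (1999), Prop. 3.3 (p. 652), Prop. 3.6 (c).
* [MoonenZarhin1999LowDim] B. Moonen, Yu. Zarhin, Math. Ann. 315 (1999) = arXiv:math/9901113, §1, §2 (2.3)–(2.4).
* [GoodmanWallachGTM255] R. Goodman, N. R. Wallach, GTM 255 (2009), §4.1.1 (the Casimir element).
* [MumfordAV1970] D. Mumford, *Abelian Varieties* (1970), §19 Cor. 2 of Thm. 1 (p. 174).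
-/

noncomputable section

open scoped TensorProduct Matrix
open CategoryTheory Module

namespace Literature.AlgebraicGeometry.HodgeTheory

open Literature.AlgebraicTopology.SingularHomology
open Literature.AlgebraicGeometry.Motives (IsSmoothProjective AbelianVariety bettiCohomology
  ofRatClassBaseChange ofRatClassBaseChange_tmul HodgeTensorFacts hodgeTensorFacts_holds)
open Literature.Barriers.HodgeConjecture
open Literature.AlgebraicGeometry.Motives.HodgeStructure
open Literature.RepresentationTheory.GeneralLinear
open Literature.NumberTheory.DiophantineGeometry
open Literature.AlgebraicGeometry.ComplexMultiplication (bettiRep bettiRep_of)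

universe u

variable {A : AbelianVariety ℂ}

/-! ### §1 `End_Hdg(H¹(A;ℚ)) = ℚ[φ^*_ℚ]` for a commutative centre of any degree -/

section Data

variable {V : Type u} [AddCommGroup V] [Module ℚ V]

/-- Rational scalars act on `V_ℂ` through `ℚ ⊆ ℂ`. [folklore] -/
private theorem ratCast_smul'' (q : ℚ) (z : ℂ ⊗[ℚ] V) : (q : ℂ) • z = q • z := by
  rw [← algebraMap_smul ℂ q z, eq_ratCast]

/-- `(Σ_{k<m} q_k φ^k)_ℂ w = (Σ_k q_k c^k) w` on `W_c = ker(φ_ℂ - c)` (`E ⊗ ℂ` acts on `H¹_σ` through `σ`; the tree's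
`baseChange_sum_smul_pow_apply` for `Fin m`). [cite: Deligne1982HodgeCycles, §4 (p. 30)] -/
theorem baseChange_sum_smul_pow_apply_fin (φ : Module.End ℚ V) {m : ℕ} (q : Fin m → ℚ) {c : ℂ} {w : ℂ ⊗[ℚ] V}
    (hw : w ∈ Module.End.eigenspace (φ.baseChange ℂ) c) :
    (∑ k, q k • φ ^ (k : ℕ)).baseChange ℂ w = (∑ k, (q k : ℂ) * c ^ (k : ℕ)) • w := by
  have h : ∀ s : Finset (Fin m), (∑ k ∈ s, q k • φ ^ (k : ℕ)).baseChange ℂ w =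
      (∑ k ∈ s, (q k : ℂ) * c ^ (k : ℕ)) • w := by
    intro s
    induction s using Finset.induction_on with
    | empty => rw [Finset.sum_empty, Finset.sum_empty, LinearMap.baseChange_zero, LinearMap.zero_apply, zero_smul]
    | insert k s hk ih =>
      rw [Finset.sum_insert hk, Finset.sum_insert hk, LinearMap.baseChange_add, LinearMap.add_apply, ih,
        LinearMap.baseChange_smul, LinearMap.smul_apply, QuarticTheta.baseChange_pow_apply φ hw,
        ← ratCast_smul'', smul_smul, add_smul]
  exact h Finset.univ

end Data

/-- **`End_Hdg(H¹(A; ℚ)) = Σ_{k<m} ℚ (φ^*_ℚ)^k` when `finrank_ℚ End⁰(A) = m` and `φ^*_ℂ` has `m` distinct eigenvalues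
with non-zero eigenspaces**: `1, φ^*_ℚ, …, (φ^*_ℚ)^{m-1}` are linearly independent (a vanishing rational combination kills
an eigenvector for each of the `m` eigenvalues: a Vandermonde system), in the `m`-dimensional `End_Hdg(H¹) ≅ End⁰(A)ᵒᵖ`
(`finrank_endAlg_hodge_one`). The tree's `exists_eq_sum_smul_pow_bettiMapHom` is `m = 4` (proof copied, `4 ↦ m`). MZ99 §2:
Type IV(`e₀`, `d²`) with `End⁰(X) = E` a CM field of degree `2e₀`. [cite: MoonenZarhin1999LowDim, §2 (2.3)–(2.4) and §1]
[cite: Deligne1982HodgeCycles, §4 (p. 30)] [cite: MumfordAV1970, §19 Cor. 2 of Thm. 1 (p. 174)] -/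
theorem exists_eq_sum_smul_pow_bettiMapHom_fin (hHD : exists_isReal_hodgeModel)
    (hI : hodgePQ_independent_of_hodgeModel) (φ : A ⟶ A) {m : ℕ} (hEm : Module.finrank ℚ A.endAlgebra = m)
    (c : Fin m → ℂ) (hc : Function.Injective c)
    (hW : ∀ j, Module.End.eigenspace ((bettiCohomology.map φ.hom.hom.hom 1).hom.baseChange ℂ) (c j) ≠ ⊥) :
    ∀ a ∈ (BettiUniverse.hodge hHD (AbelianVariety.isSmoothProjective_holds (A := A)) 1).endAlg,
      ∃ q : Fin m → ℚ, a = ∑ k, q k • (bettiCohomology.map φ.hom.hom.hom 1).hom ^ (k : ℕ) := by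
  classical
  intro a ha
  haveI : Module.Finite ℚ (bettiCohomology A.X 1) := finite_bettiCohomology_one A
  set φQ : Module.End ℚ (bettiCohomology A.X 1) := (bettiCohomology.map φ.hom.hom.hom 1).hom with hφQ
  have hφE : φQ ∈ (BettiUniverse.hodge hHD (AbelianVariety.isSmoothProjective_holds (A := A)) 1).endAlg := by
    have h := unop_bettiRep_mem_endAlg hHD hI (AbelianVariety.endAlgebra.of A φ)
    rwa [bettiRep_of, MulOpposite.unop_op] at h
  -- `1, φQ, …, φQ^{m-1}` linearly independent
  have hli : LinearIndependent ℚ (fun k : Fin m => φQ ^ (k : ℕ)) := by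
    rw [Fintype.linearIndependent_iff]
    intro q hq
    -- evaluate on an eigenvector for each eigenvalue
    have hvan : ∀ j, ∑ k, (q k : ℂ) * c j ^ (k : ℕ) = 0 := by
      intro j
      obtain ⟨w, hw, hw0⟩ := (Submodule.ne_bot_iff _).1 (hW j)
      have h := baseChange_sum_smul_pow_apply_fin φQ q hw
      rw [hq, LinearMap.baseChange_zero, LinearMap.zero_apply] at h
      exact (smul_eq_zero.1 h.symm).resolve_right hw0
    have hmul : (Matrix.vandermonde c).mulVec (fun k => (q k : ℂ)) = 0 := by
      funext j
      rw [Matrix.mulVec, Pi.zero_apply]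
      change ∑ k, Matrix.vandermonde c j k * (q k : ℂ) = 0
      simp only [Matrix.vandermonde_apply]
      rw [← hvan j]
      exact Finset.sum_congr rfl fun k _ => mul_comm _ _
    have hdet : (Matrix.vandermonde c).det ≠ 0 := Matrix.det_vandermonde_ne_zero_iff.2 hc
    have h0 := Matrix.eq_zero_of_mulVec_eq_zero hdet hmul
    intro k
    have hk := congrFun h0 k
    rw [Pi.zero_apply, Rat.cast_eq_zero] at hk
    exact hk
  -- `span = End_Hdg` by dimension
  set P := Submodule.span ℚ (Set.range fun k : Fin m => φQ ^ (k : ℕ)) with hP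
  have hPle : P ≤ Subalgebra.toSubmodule
      (BettiUniverse.hodge hHD (AbelianVariety.isSmoothProjective_holds (A := A)) 1).endAlg := by
    refine Submodule.span_le.2 ?_
    rintro _ ⟨k, rfl⟩
    exact Subalgebra.pow_mem _ hφE _
  have hPrank : Module.finrank ℚ P = m := by
    rw [hP, finrank_span_eq_card hli, Fintype.card_fin]
  have hErank : Module.finrank ℚ (Subalgebra.toSubmodule
      (BettiUniverse.hodge hHD (AbelianVariety.isSmoothProjective_holds (A := A)) 1).endAlg) = m := by
    rw [Subalgebra.finrank_toSubmodule, finrank_endAlg_hodge_one hHD hI, hEm]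
  have hPeq := Submodule.eq_of_le_of_finrank_le hPle (by rw [hPrank, hErank])
  have haP : a ∈ P := by
    rw [hPeq, Subalgebra.mem_toSubmodule]
    exact ha
  rw [hP, Submodule.mem_span_range_iff_exists_fun] at haP
  obtain ⟨cf, hcf⟩ := haP
  exact ⟨cf, hcf.symm⟩

/-! ### §2 The crossed class of each colour is a divisor class: Casimir classes of the powers of `φ` and Lagrange interpolation -/

/-- **`θ_k = ∑_ℓ ρ(cb((k,0),ℓ)) ⌣ ρ(cb((k,1),ℓ)) ∈ B¹(A) ⊗ ℂ` for EACH colour `k : ι`**, for adapted `ψ_ℂ`-dual bases `cb` of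
`H¹ ⊗ ℂ = ⊕_c W_c` (pairing table `δ_{kk'}δ_{ij}` across types, `0` on equal types) with `φ_ℂ = μ k` on `cb((k,0),·)` and
`conj μ k` on `cb((k,1),·)`, `φ` RATIONAL, the `2|ι|` numbers `μ k`, `conj μ k` pairwise distinct. The `ψ_ℂ`-dual family of `cb`
is `((k,0),ℓ) ↦ -cb((k,1),ℓ)`, `((k,1),ℓ) ↦ cb((k,0),ℓ)`, so the `ψ`-Casimir class `Λ(T)` of an operator acting on
`cb((k,t),·)` by scalars `s(k,t)`, computed in a rational basis (`sum_dual_eq_sum_dual`), is `∑_k (s(k,0) + s(k,1)) θ_k`; for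
`T = (φ^j)_ℂ` these are RATIONAL `(1,1)`-classes (`isRationalClass_casimirClass_baseChange`) with coefficient vectors
`((μ k)^j + (conj μ k)^j)_k`; the Lagrange basis polynomial `L` of the node `μ k` among the `2|ι|` distinct eigenvalues
(`Lagrange.basis`, `eval_basis_self`, `eval_basis_of_ne`) gives `Σ_j L_j Λ((φ^j)_ℂ) = Σ_{k'} (L(μ k') + L(conj μ k')) θ_{k'} = θ_k`.
(Milne Prop. 3.3: the pairing class of each `W_σ ⊗ W_σ^∨` is a divisor class; Goodman–Wallach §4.1.1: the Casimir element
is independent of the dual bases. The setup is VERBATIM the tree's two-colour `sum_cupH1_colour_mem_span_rational_oneOne`,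
credited; only the separation step is new.) [cite: Milne1999LefschetzClasses, Prop. 3.3 (p. 652)]
[cite: GoodmanWallachGTM255, §4.1.1] [cite: Deligne1982HodgeCycles, §4 (p. 30)] [cite: MoonenZarhin1999LowDim, §2 (2.3)] -/
theorem sum_cupH1_cmColour_mem_span_rational_oneOne [HodgeTensorFacts.{0, 0}] {ι : Type} [Fintype ι] [DecidableEq ι]
    (hHD : exists_isReal_hodgeModel) (hI : hodgePQ_independent_of_hodgeModel)
    (ψ : (BettiUniverse.hodge hHD (AbelianVariety.isSmoothProjective_holds (A := A)) 1).Polarization)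
    (φ : Module.End ℚ (bettiCohomology A.X 1)) (μ : ι → ℂ)
    (hev : Function.Injective fun kt : ι × Fin 2 => if kt.2 = 0 then μ kt.1 else starRingEnd ℂ (μ kt.1))
    {n₀ : ℕ} (cb : Module.Basis ((ι × Fin 2) × Fin n₀) ℂ (ℂ ⊗[ℚ] bettiCohomology A.X 1))
    (κ : ι × Fin n₀ → Fin 2)
    (hcbW : ∀ k ℓ, cb ((k, 0), ℓ) ∈ Module.End.eigenspace (φ.baseChange ℂ) (μ k))
    (hcbW' : ∀ k ℓ, cb ((k, 1), ℓ) ∈ Module.End.eigenspace (φ.baseChange ℂ) (starRingEnd ℂ (μ k)))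
    (hcb0 : ∀ k ℓ, κ (k, ℓ) = 0 →
      cb ((k, 0), ℓ) ∈ (BettiUniverse.hodge hHD (AbelianVariety.isSmoothProjective_holds (A := A)) 1).piece 1 0 ∧
      cb ((k, 1), ℓ) ∈ (BettiUniverse.hodge hHD (AbelianVariety.isSmoothProjective_holds (A := A)) 1).piece 0 1)
    (hcb1 : ∀ k ℓ, κ (k, ℓ) = 1 →
      cb ((k, 0), ℓ) ∈ (BettiUniverse.hodge hHD (AbelianVariety.isSmoothProjective_holds (A := A)) 1).piece 0 1 ∧
      cb ((k, 1), ℓ) ∈ (BettiUniverse.hodge hHD (AbelianVariety.isSmoothProjective_holds (A := A)) 1).piece 1 0)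
    (hdual : ∀ k k' i j, ψ.form.baseChange ℂ (cb ((k, 0), i)) (cb ((k', 1), j)) =
      if k = k' ∧ i = j then 1 else 0)
    (hiso : ∀ k k' (t : Fin 2) i j, ψ.form.baseChange ℂ (cb ((k, t), i)) (cb ((k', t), j)) = 0) (k : ι) :
    (∑ ℓ, cupH1 A (cb ((k, 0), ℓ)) (cb ((k, 1), ℓ))) ∈
      Submodule.span ℂ {c : complexBetti A.X 2 | IsRationalClass c ∧ IsOfHodgeType A.dim A.X 2 1 1 c} := by
  classical
  -- (setup: the tree's `sum_cupH1_colour_mem_span_rational_oneOne`, cell pub-hodge-ring2 R10, with `Fin 2 ↦ ι`)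
  have hX : IsSmoothProjective A.dim A.X := AbelianVariety.isSmoothProjective_holds
  haveI : Module.Finite ℚ (bettiCohomology A.X 1) := finite_bettiCohomology_one A
  set S := Submodule.span ℂ
    {c : complexBetti A.X 2 | IsRationalClass c ∧ IsOfHodgeType A.dim A.X 2 1 1 c} with hS
  set Ψ := ψ.form.baseChange ℂ with hΨ
  have hswap : ∀ x y, Ψ y x = -Ψ x y := fun x y => by
    rw [hΨ, ψ.form_baseChange_swap, show (((1 : ℕ) : ℤ)).negOnePow = -1 from Int.negOnePow_one]
    simp
  have h2 : ∀ r : Fin 2, r = 0 ∨ r = 1 := fun r => by fin_cases r <;> simp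
  -- the `ψ_ℂ`-dual family `d'` of `cb`
  set d' : (ι × Fin 2) × Fin n₀ → ℂ ⊗[ℚ] bettiCohomology A.X 1 :=
    fun x => if x.1.2 = 0 then -cb ((x.1.1, 1), x.2) else cb ((x.1.1, 0), x.2) with hd'
  have hd'0 : ∀ k' i, d' ((k', 0), i) = -cb ((k', 1), i) := fun k' i => by simp [hd']
  have hd'1 : ∀ k' i, d' ((k', 1), i) = cb ((k', 0), i) := fun k' i => by simp [hd']
  have hdual' : ∀ x y, Ψ (d' x) (cb y) = if y = x then 1 else 0 := by
    rintro ⟨⟨k₁, t₁⟩, i⟩ ⟨⟨k₂, t₂⟩, j⟩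
    rcases h2 t₁ with rfl | rfl <;> rcases h2 t₂ with rfl | rfl
    · rw [hd'0, map_neg, LinearMap.neg_apply, hswap, neg_neg, hΨ, hdual]
      by_cases h : k₂ = k₁ ∧ j = i
      · rw [if_pos h, if_pos (by rw [h.1, h.2])]
      · rw [if_neg h, if_neg (fun h' => h (by simp only [Prod.mk.injEq] at h'; exact ⟨h'.1.1, h'.2⟩))]
    · rw [hd'0, map_neg, LinearMap.neg_apply, hΨ, hiso, neg_zero, if_neg (fun h' => ?_)]
      simp only [Prod.mk.injEq] at h'
      exact absurd h'.1.2 (by decide)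
    · rw [hd'1, hΨ, hiso, if_neg (fun h' => ?_)]
      simp only [Prod.mk.injEq] at h'
      exact absurd h'.1.2 (by decide)
    · rw [hd'1, hΨ, hdual]
      by_cases h : k₁ = k₂ ∧ i = j
      · rw [if_pos h, if_pos (by rw [h.1, h.2])]
      · rw [if_neg h, if_neg (fun h' => h (by simp only [Prod.mk.injEq] at h'; exact ⟨h'.1.1.symm, h'.2.symm⟩))]
  have hsep : ∀ y, (∀ x, Ψ (d' x) y = 0) → y = 0 := by
    intro y hy
    have hb : ∀ x : (ι × Fin 2) × Fin n₀, Ψ (cb x) y = 0 := by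
      rintro ⟨⟨k', t⟩, i⟩
      rcases h2 t with rfl | rfl
      · have h1 := hy ((k', 1), i)
        rwa [hd'1] at h1
      · have h0 := hy ((k', 0), i)
        rwa [hd'0, map_neg, LinearMap.neg_apply, neg_eq_zero] at h0
    refine ψ.eq_zero_of_forall_form_eq_zero' fun x => ?_
    rw [← cb.sum_repr x, map_sum, LinearMap.sum_apply]
    exact Finset.sum_eq_zero fun tk _ => by rw [map_smul, LinearMap.smul_apply, ← hΨ, hb, smul_zero]
  -- the crossed classes `θ k'` and graded commutativity
  set θ : ι → complexBetti A.X 2 := fun k' => ∑ ℓ, cupH1 A (cb ((k', 0), ℓ)) (cb ((k', 1), ℓ)) with hθ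
  have hgc : ∀ k' ℓ, cupH1 A (cb ((k', 1), ℓ)) (cb ((k', 0), ℓ)) = -cupH1 A (cb ((k', 0), ℓ)) (cb ((k', 1), ℓ)) :=
    fun k' ℓ => by
      rw [cupH1_apply, cupH1_apply, cupProduct_gradedComm_holds ℂ (Motives.ComplexPoints A.X)
        (rfl : 1 + 1 = 2) (rfl : 1 + 1 = 2)]
      norm_num
  -- the Casimir class of an operator acting by scalars on the adapted basis
  set eQ := Module.finBasis ℚ (bettiCohomology A.X 1) with heQ
  have hcas : ∀ (T : Module.End ℂ (ℂ ⊗[ℚ] bettiCohomology A.X 1)) (s : ι × Fin 2 → ℂ),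
      (∀ (kt : ι × Fin 2) ℓ, T (cb (kt, ℓ)) = s kt • cb (kt, ℓ)) →
      casimirClass A ψ.form ψ.nondegenerate eQ T = ∑ k', (s (k', 0) + s (k', 1)) • θ k' := by
    intro T s hT
    rw [casimirClass_apply, sum_dual_eq_sum_dual Ψ (cupH1 A) _ _
      (eq_sum_formBaseChange_smul_dualBasis ψ.form ψ.nondegenerate eQ) (⇑cb) d' hdual' hsep T,
      Fintype.sum_prod_type, Fintype.sum_prod_type]
    refine Finset.sum_congr rfl fun k' _ => ?_
    rw [Fin.sum_univ_two, hθ]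
    simp only [hd'0, hd'1, map_neg, hT, map_smul, LinearMap.neg_apply, LinearMap.smul_apply, hgc,
      Finset.smul_sum, ← Finset.sum_add_distrib, add_smul]
    exact Finset.sum_congr rfl fun ℓ _ => by module
  -- Hodge type `(1,1)` of each `θ k'`
  have hcup := BettiUniverse.cupPreservesHodgeType hHD hI hX
  obtain ⟨M⟩ := nonempty_hodgeModel_holds hX
  have htype : ∀ k', IsOfHodgeType A.dim A.X 2 1 1 (θ k') := by
    intro k'
    refine IsOfHodgeType.sum hX M _ _ fun ℓ _ => ?_
    rw [cupH1_apply]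
    rcases h2 (κ (k', ℓ)) with h | h
    · have h10 := (BettiUniverse.mem_hodge_piece_iff hHD hI hX (k := 1) (p := 1) (q := 0) rfl _).1 (hcb0 k' ℓ h).1
      have h01 := (BettiUniverse.mem_hodge_piece_iff hHD hI hX (k := 1) (p := 0) (q := 1) rfl _).1 (hcb0 k' ℓ h).2
      have h' : IsOfHodgeType A.dim A.X 2 (1 + 0) (0 + 1) _ := hcup (rfl : 1 + 1 = 2) h10 h01
      exact h'
    · have h01 := (BettiUniverse.mem_hodge_piece_iff hHD hI hX (k := 1) (p := 0) (q := 1) rfl _).1 (hcb1 k' ℓ h).1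
      have h10 := (BettiUniverse.mem_hodge_piece_iff hHD hI hX (k := 1) (p := 1) (q := 0) rfl _).1 (hcb1 k' ℓ h).2
      have h' : IsOfHodgeType A.dim A.X 2 (0 + 1) (1 + 0) _ := hcup (rfl : 1 + 1 = 2) h01 h10
      exact h'
  -- the rational `(1,1)`-classes `Λ(a_ℂ) = Σ_k (s_a(k,0) + s_a(k,1)) θ_k` for `a ∈ End_Hdg` diagonal on `cb`
  have hmemS : ∀ (a : Module.End ℚ (bettiCohomology A.X 1)) (s : ι × Fin 2 → ℂ),
      (∀ (kt : ι × Fin 2) ℓ, a.baseChange ℂ (cb (kt, ℓ)) = s kt • cb (kt, ℓ)) →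
      (∑ k', (s (k', 0) + s (k', 1)) • θ k') ∈ S := by
    intro a s ha
    rw [← hcas _ s ha]
    refine Submodule.subset_span ⟨isRationalClass_casimirClass_baseChange ψ.form ψ.nondegenerate eQ a, ?_⟩
    rw [hcas _ s ha]
    exact IsOfHodgeType.sum hX M _ _ fun k' _ => (htype k').smul _
  -- the eigenvalues `ev (k,0) = μ k`, `ev (k,1) = conj μ k` and the powers of `φ`
  set ev : ι × Fin 2 → ℂ := fun kt => if kt.2 = 0 then μ kt.1 else starRingEnd ℂ (μ kt.1) with hevdef
  have hev0 : ∀ k', ev (k', 0) = μ k' := fun k' => by simp [hevdef]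
  have hev1 : ∀ k', ev (k', 1) = starRingEnd ℂ (μ k') := fun k' => by simp [hevdef]
  have hevW : ∀ (kt : ι × Fin 2) ℓ, cb (kt, ℓ) ∈ Module.End.eigenspace (φ.baseChange ℂ) (ev kt) := by
    rintro ⟨k', t⟩ ℓ
    rcases h2 t with rfl | rfl
    · rw [hev0]; exact hcbW k' ℓ
    · rw [hev1]; exact hcbW' k' ℓ
  have hRpow : ∀ j : ℕ, (∑ k', (ev (k', 0) ^ j + ev (k', 1) ^ j) • θ k') ∈ S := fun j =>
    hmemS (φ ^ j) (fun kt => ev kt ^ j) fun kt ℓ => QuarticTheta.baseChange_pow_apply φ (hevW kt ℓ) j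
  -- Lagrange interpolation at the node `(k, 0)` among the `2|ι|` distinct eigenvalues
  set L : Polynomial ℂ := Lagrange.basis Finset.univ ev (k, 0) with hL
  have hLk : L.eval (ev (k, 0)) = 1 := by
    rw [hL]
    exact Lagrange.eval_basis_self (hev.injOn) (Finset.mem_univ _)
  have hLne : ∀ kt, kt ≠ (k, 0) → L.eval (ev kt) = 0 := fun kt hkt => by
    rw [hL]
    exact Lagrange.eval_basis_of_ne (Ne.symm hkt) (Finset.mem_univ _)
  have hval : ∀ k', L.eval (ev (k', 0)) + L.eval (ev (k', 1)) = if k' = k then 1 else 0 := by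
    intro k'
    rw [hLne (k', 1) (fun h => by simp [Prod.ext_iff] at h)]
    by_cases hk : k' = k
    · subst hk; rw [hLk, add_zero, if_pos rfl]
    · rw [hLne (k', 0) (fun h => hk (by simpa [Prod.ext_iff] using h)), add_zero, if_neg hk]
  have hcomb : (∑ j ∈ Finset.range (L.natDegree + 1),
      L.coeff j • ∑ k', (ev (k', 0) ^ j + ev (k', 1) ^ j) • θ k') ∈ S :=
    Submodule.sum_mem _ fun j _ => Submodule.smul_mem _ _ (hRpow j)
  have hre : (∑ j ∈ Finset.range (L.natDegree + 1),
      L.coeff j • ∑ k', (ev (k', 0) ^ j + ev (k', 1) ^ j) • θ k') =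
        ∑ k', (L.eval (ev (k', 0)) + L.eval (ev (k', 1))) • θ k' := by
    simp only [Finset.smul_sum, smul_smul]
    rw [Finset.sum_comm]
    refine Finset.sum_congr rfl fun k' _ => ?_
    rw [← Finset.sum_smul, Polynomial.eval_eq_sum_range, Polynomial.eval_eq_sum_range, ← Finset.sum_add_distrib]
    refine congrArg (· • θ k') (Finset.sum_congr rfl fun j _ => ?_)
    ring
  rw [hre] at hcomb
  simp only [hval, ite_smul, one_smul, zero_smul, Finset.sum_ite_eq', Finset.mem_univ, if_true] at hcomb
  exact hcomb

end Literature.AlgebraicGeometry.HodgeTheory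

end
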